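import Mathlib
import HarnessLib
import Summits.KontsevichZagierPeriods.Statement
import Literature.NumberTheory.Transcendental.KZCalculus
import Literature.NumberTheory.Transcendental.KZKernelConjectureForms
import Literature.NumberTheory.Transcendental.KZLogCalculusProofs
import Literature.NumberTheory.Transcendental.KZDominatedFamilyRelations
import Literature.ModelTheory.ExponentialFields.CylindricalDecompositionProofs

/-!
# `RegFoldingDegOne` (route `RootDecompRelativeModAbsolute`, support item stmt-KontsevichZagierPeriods-30571) — PROVED · part 1/14

Cell `decomp-kz`, lens 3 (decomp-kz-lens-3 g9): `regFoldingDegOne_holds :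
Theses.RootDecompRelativeModAbsolute.RegFoldingDegOne` BY NAME (in part 14/14) — every Kontsevich–Zagier
integral representation on `ℝ²` whose integrand is a quotient `p/q` of `ℚ`-polynomials with `deg_t q ≤ 1`,
`q ≠ 0` on the domain, is equivalent in `KZ.relations` to `[g] + Σᵢ [Uᵢ]`, the `Uᵢ` honest 2-cells
`[g.domain × (0,1), hᵢ(x) θ^{Mᵢ}/(1 + θ^{eᵢ} κᵢ(x))]` (unfolded REGULARISED log/arctan monomials), with the
fibre integrals matching a.e.  Architecture: §1–§2 regularised terms `RTerm`, `RegFolding d`; §7 a.e.-congruence;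
§8 gluing (`FoldsTo`); §9 one-band toolkit; §P analytic core (kernel independence); §10 cylinders; §11 affine band
chart; §13 `RegFolding 1` from a CAD band cover a.e. + vanishing on unbounded bands; last part: the edge to the born
item text and `regFoldingDegOne_holds`.

Source: `HOME/decomp-kz-lens-3/g9/landing/RootDecompRelativeModAbsoluteRegFoldingDegOne.lean` sha256 60038aa44a5f6303
(4275 l; critic decomp-kz-crit-1 g2 CLEARED/kernel-confirmed 2026-08-30T09:41:19Z, std axioms), split mechanically
into 14 modules ≤ 400 lines by the landing seat decomp-kz-census-1 g7 (contexts re-opened per part; generic docstrings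
added where the source had none; parts 1–13 do not import the route file).  No `sorry`; standard axioms.
References: [cite: KontsevichZagier2001, §1.2]; Basu–Pollack–Roy 2006 Def. 5.1 / Cor. 5.7; Bochnak–Coste–Roy 1998 §2.9.
-/

noncomputable section

open Set MeasureTheory Filter Topology
open scoped BigOperators
open Literature.NumberTheory.Transcendental Literature.ModelTheory.ExponentialFields

namespace Summit.KontsevichZagierPeriods.RootDecompRelativeModAbsolute.Rung30571

namespace RegularisedLogLayer

/-! ## §0 The summit in kernel form; Fubini along the last coordinate (verbatim from the g7 node file) -/

/-- The summit in kernel form (`KZKernelConjecture`). [folklore] -/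
theorem kernel_of_summit (h : _root_.KontsevichZagierPeriods) (c : KZ.FormalRep)
    (hc : KZ.eval c = 0) : c ∈ KZ.relations :=
  (kzKernelConjecture_iff_isRational.mpr (KontsevichZagierPeriods_iff.mp h)) c hc

section Fubini

variable {b : ℕ}

/-- `t ↦ Fin.snoc x t` is measurable. [folklore] -/
theorem measurable_snoc (x : Fin b → ℝ) :
    Measurable fun t : ℝ => (Fin.snoc x t : Fin (b + 1) → ℝ) := by
  have hx : (fun t : ℝ => (Fin.snoc x t : Fin (b + 1) → ℝ)) =
      fun t => (MeasurableEquiv.piFinSuccAbove (fun _ => ℝ) (Fin.last b)).symm (t, x) := by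
    funext t
    simp [MeasurableEquiv.piFinSuccAbove, Fin.snocEquiv]
  rw [hx]
  exact (MeasurableEquiv.measurable _).comp (measurable_id.prodMk measurable_const)

/-- Transport of integrability along `ℝᵇ⁺¹ ≃ ℝ × ℝᵇ`, inverse `(t, x) ↦ Fin.snoc x t`. [folklore] -/
theorem integrable_snoc_prod {G : (Fin (b + 1) → ℝ) → ℝ} (hG : Integrable G) :
    Integrable (fun p : ℝ × (Fin b → ℝ) => G (Fin.snoc p.2 p.1))
      ((volume : Measure ℝ).prod (volume : Measure (Fin b → ℝ))) := by
  set e : (Fin (b + 1) → ℝ) ≃ᵐ ℝ × (Fin b → ℝ) :=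
    MeasurableEquiv.piFinSuccAbove (fun _ => ℝ) (Fin.last b) with he_def
  have he : MeasurePreserving e volume volume :=
    volume_preserving_piFinSuccAbove (fun _ => ℝ) (Fin.last b)
  have he_symm : ∀ p : ℝ × (Fin b → ℝ), e.symm p = Fin.snoc p.2 p.1 := fun p => by
    simp [he_def, MeasurableEquiv.piFinSuccAbove, Fin.snocEquiv]
  have h := ((he.symm e).integrable_comp_emb e.symm.measurableEmbedding (g := G)).mpr hG
  rw [← Measure.volume_eq_prod]
  convert h using 1
  ext p
  simp [he_symm]

/-- Fubini along `Fin.snoc`: `∫ z, G z = ∫ x, ∫ t, G (Fin.snoc x t)`. [folklore] -/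
theorem integral_eq_integral_snoc {G : (Fin (b + 1) → ℝ) → ℝ} (hG : Integrable G) :
    ∫ z, G z = ∫ x : Fin b → ℝ, ∫ t : ℝ, G (Fin.snoc x t) := by
  set e : (Fin (b + 1) → ℝ) ≃ᵐ ℝ × (Fin b → ℝ) :=
    MeasurableEquiv.piFinSuccAbove (fun _ => ℝ) (Fin.last b) with he_def
  have he : MeasurePreserving e volume volume :=
    volume_preserving_piFinSuccAbove (fun _ => ℝ) (Fin.last b)
  have he_symm : ∀ p : ℝ × (Fin b → ℝ), e.symm p = Fin.snoc p.2 p.1 := fun p => by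
    simp [he_def, MeasurableEquiv.piFinSuccAbove, Fin.snocEquiv]
  calc ∫ z, G z = ∫ p, G (e.symm p) := ((he.symm e).integral_comp' G).symm
    _ = ∫ p : ℝ × (Fin b → ℝ), G (Fin.snoc p.2 p.1) ∂(volume.prod volume) := by
        simp_rw [he_symm, Measure.volume_eq_prod]
    _ = ∫ x, ∫ t, G (Fin.snoc x t) := integral_prod_symm _ (integrable_snoc_prod hG)

/-- The fibre integral is the integral of the zero-extended integrand along the fibre. [folklore] -/
theorem integral_indicator_snoc (r : KZ.IntegralRep (b + 1)) (x : Fin b → ℝ) :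
    ∫ t, r.domain.indicator r.integrand (Fin.snoc x t) =
      ∫ t in {t : ℝ | (Fin.snoc x t : Fin (b + 1) → ℝ) ∈ r.domain}, r.integrand (Fin.snoc x t) := by
  have hbm : MeasurableSet r.domain := KZ.IntegralRep.measurableSet_domain_holds r
  have hfun : (fun t => r.domain.indicator r.integrand (Fin.snoc x t)) =
      {t : ℝ | (Fin.snoc x t : Fin (b + 1) → ℝ) ∈ r.domain}.indicator
        (fun t => r.integrand (Fin.snoc x t)) := by
    funext t
    exact (Set.indicator_comp_right (fun t : ℝ => (Fin.snoc x t : Fin (b + 1) → ℝ))).symm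
  rw [hfun]
  exact integral_indicator (measurable_snoc x hbm)

/-- Fubini for representations of dimension `b + 1`. [folklore] -/
theorem value_eq_integral_fibre (r : KZ.IntegralRep (b + 1)) :
    r.value = ∫ x : Fin b → ℝ, ∫ t in {t : ℝ | (Fin.snoc x t : Fin (b + 1) → ℝ) ∈ r.domain},
      r.integrand (Fin.snoc x t) := by
  have hbm : MeasurableSet r.domain := KZ.IntegralRep.measurableSet_domain_holds r
  have hG : Integrable (r.domain.indicator r.integrand) :=
    (integrable_indicator_iff hbm).mpr r.integrableOn
  unfold KZ.IntegralRep.value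
  rw [← integral_indicator hbm, integral_eq_integral_snoc hG]
  exact integral_congr_ae (Filter.Eventually.of_forall fun x => integral_indicator_snoc r x)

/-- Equal fibre integrals a.e. ⇒ equal values. [folklore] -/
theorem value_eq_of_fibre_ae (r r' : KZ.IntegralRep (b + 1))
    (h : ∀ᵐ x : (Fin b → ℝ), (∫ t in {t : ℝ | (Fin.snoc x t : Fin (b + 1) → ℝ) ∈ r.domain},
        r.integrand (Fin.snoc x t)) =
      ∫ t in {t : ℝ | (Fin.snoc x t : Fin (b + 1) → ℝ) ∈ r'.domain}, r'.integrand (Fin.snoc x t)) :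
    r.value = r'.value := by
  rw [value_eq_integral_fibre r, value_eq_integral_fibre r']
  exact integral_congr_ae h

/-- Kernel of a pair with a.e.-equal fibre integrals under the summit. [folklore] -/
theorem of_sub_of_mem_of_summit (h : _root_.KontsevichZagierPeriods)
    (r r' : KZ.IntegralRep (b + 1))
    (he : ∀ᵐ x : (Fin b → ℝ), (∫ t in {t : ℝ | (Fin.snoc x t : Fin (b + 1) → ℝ) ∈ r.domain},
        r.integrand (Fin.snoc x t)) =
      ∫ t in {t : ℝ | (Fin.snoc x t : Fin (b + 1) → ℝ) ∈ r'.domain}, r'.integrand (Fin.snoc x t)) :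
    KZ.of r - KZ.of r' ∈ KZ.relations := by
  refine kernel_of_summit h _ ?_
  rw [map_sub, KZ.eval_of, KZ.eval_of, value_eq_of_fibre_ae r r' he, sub_self]

end Fubini

/-! ## §1 Regularised log/arctan terms (the posited object) -/

/-- The regularised monomial kernel `θ^M / (1 + θ^e κ)` (`e = 1`: logarithmic, `e = 2`: arctangent). -/
def kernel (M e : ℕ) (κ θ : ℝ) : ℝ := θ ^ M / (1 + θ ^ e * κ)

/-- The regularised logarithm / arctangent `ℓ_{M,e}(κ) = ∫₀¹ θ^M dθ/(1 + θ^e κ)`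
(`ℓ_{0,1}(κ) = log(1+κ)/κ`, `ℓ_{0,2}(u²) = arctan(u)/u`). -/
def ell (M e : ℕ) (κ : ℝ) : ℝ := ∫ θ in Ioo (0 : ℝ) 1, kernel M e κ θ

/-- A **regularised term** `[σ; h₀; (hᵢ, κᵢ, Mᵢ, eᵢ)ᵢ]` in base dimension `n` (DATA). -/
structure RTerm (n : ℕ) where
  /-- base domain `σ ⊆ ℝⁿ` -/
  domain : Set (Fin n → ℝ)
  /-- rational (monomial-free) part -/
  h₀ : (Fin n → ℝ) → ℝ
  /-- number of monomials -/
  k : ℕ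
  /-- coefficients -/
  h : Fin k → (Fin n → ℝ) → ℝ
  /-- arguments (`κᵢ > −1`) -/
  κ : Fin k → (Fin n → ℝ) → ℝ
  /-- Taylor orders -/
  M : Fin k → ℕ
  /-- kinds (`1` = log, `2` = arctan) -/
  e : Fin k → ℕ

namespace RTerm

variable {n : ℕ}

/-- The function `h₀ + Σᵢ hᵢ ℓ_{Mᵢ,eᵢ}(κᵢ)` of a regularised term. -/
def integrand (T : RTerm n) (x : Fin n → ℝ) : ℝ :=
  T.h₀ x + ∑ i, T.h i x * ell (T.M i) (T.e i) (T.κ i x)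

/-- The open cylinder `σ × (0,1) ⊆ ℝⁿ⁺¹`. -/
def cyl (σ : Set (Fin n → ℝ)) : Set (Fin (n + 1) → ℝ) :=
  {z | Fin.init z ∈ σ ∧ z (Fin.last n) ∈ Ioo (0 : ℝ) 1}

/-- The integrand `hᵢ(x) θ^{Mᵢ}/(1 + θ^{eᵢ} κᵢ(x))` of the `i`-th unfolded monomial. -/
def monomialFun (T : RTerm n) (i : Fin T.k) (z : Fin (n + 1) → ℝ) : ℝ :=
  T.h i (Fin.init z) * kernel (T.M i) (T.e i) (T.κ i (Fin.init z)) (z (Fin.last n))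

/-- **Admissibility** of a regularised term: `ℚ`-semialgebraic data, `κᵢ > −1`, kinds in `{1,2}`, `h₀`
integrable, and every UNFOLDED MONOMIAL an honest KZ integral representation on the cylinder (its
integrand has constant sign in `θ`, so this is `hᵢ ℓ(κᵢ) ∈ L¹(σ)` — recorded separately as
`integrableOn_monomial_base`, a consequence kept as a field to keep this node file short; likewise the
semialgebraicity of the monomial integrand, which follows from that of `hᵢ, κᵢ`). -/
structure Admissible (T : RTerm n) : Prop where
  isSemialgebraic_domain : IsSemialgebraic ℚ T.domain
  isSemialgebraicFunOn_h₀ : IsSemialgebraicFunOn ℚ T.domain T.h₀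
  integrableOn_h₀ : IntegrableOn T.h₀ T.domain
  isSemialgebraicFunOn_h : ∀ i, IsSemialgebraicFunOn ℚ T.domain (T.h i)
  isSemialgebraicFunOn_κ : ∀ i, IsSemialgebraicFunOn ℚ T.domain (T.κ i)
  e_mem : ∀ i, T.e i = 1 ∨ T.e i = 2
  neg_one_lt_κ : ∀ i, ∀ x ∈ T.domain, -1 < T.κ i x
  isSemialgebraicFunOn_monomial : ∀ i, IsSemialgebraicFunOn ℚ (cyl T.domain) (T.monomialFun i)
  integrableOn_monomial : ∀ i, IntegrableOn (T.monomialFun i) (cyl T.domain)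
  integrableOn_monomial_base :
    ∀ i, IntegrableOn (fun x => T.h i x * ell (T.M i) (T.e i) (T.κ i x)) T.domain

/-- The cylinder over a `ℚ`-semialgebraic base is `ℚ`-semialgebraic. [folklore] -/
theorem isSemialgebraic_cyl {σ : Set (Fin n → ℝ)} (hσ : IsSemialgebraic ℚ σ) :
    IsSemialgebraic ℚ (cyl σ) := by
  have h1 := isSemialgebraic_setOf_eval_pos (k := ℚ) (R := ℝ) (MvPolynomial.X (Fin.last n))
  have h2 := isSemialgebraic_setOf_eval_lt (k := ℚ) (R := ℝ) (MvPolynomial.X (Fin.last n)) 1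
  convert hσ.setOf_init_mem.inter (h1.inter h2) using 1
  ext z
  simp only [cyl, mem_Ioo, mem_setOf_eq, mem_inter_iff, MvPolynomial.aeval_X, map_one]

/-- The base representation `[σ, h₀]`. -/
def baseRep (T : RTerm n) (hT : T.Admissible) : KZ.IntegralRep n :=
  ⟨T.domain, T.h₀, hT.isSemialgebraic_domain, hT.isSemialgebraicFunOn_h₀, hT.integrableOn_h₀⟩

/-- The `i`-th **unfolded monomial** `[σ × (0,1), hᵢ(x) θ^{Mᵢ}/(1 + θ^{eᵢ} κᵢ(x))]` (honest by
admissibility). -/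
def monomialRep (T : RTerm n) (hT : T.Admissible) (i : Fin T.k) : KZ.IntegralRep (n + 1) :=
  ⟨cyl T.domain, T.monomialFun i, isSemialgebraic_cyl hT.isSemialgebraic_domain,
    hT.isSemialgebraicFunOn_monomial i, hT.integrableOn_monomial i⟩

/-- The **unfolding** `[σ, h₀] + Σᵢ [monomialᵢ]` of an admissible regularised term. -/
def unfold (T : RTerm n) (hT : T.Admissible) : KZ.FormalRep :=
  KZ.of (baseRep T hT) + ∑ i, KZ.of (monomialRep T hT i)

/-- `baseRep_domain`: auxiliary theorem of the `RegFoldingDegOne` (stmt-30571) development — see the module docstring; statement and proof verbatim from the lens-3 g9 landing file. -/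
@[simp] theorem baseRep_domain (T : RTerm n) (hT : T.Admissible) : (baseRep T hT).domain = T.domain := rfl
/-- `baseRep_integrand`: auxiliary theorem of the `RegFoldingDegOne` (stmt-30571) development — see the module docstring; statement and proof verbatim from the lens-3 g9 landing file. -/
@[simp] theorem baseRep_integrand (T : RTerm n) (hT : T.Admissible) :
    (baseRep T hT).integrand = T.h₀ := rfl
/-- `monomialRep_domain`: auxiliary theorem of the `RegFoldingDegOne` (stmt-30571) development — see the module docstring; statement and proof verbatim from the lens-3 g9 landing file. -/
@[simp] theorem monomialRep_domain (T : RTerm n) (hT : T.Admissible) (i : Fin T.k) :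
    (monomialRep T hT i).domain = cyl T.domain := rfl
/-- `monomialRep_integrand`: auxiliary theorem of the `RegFoldingDegOne` (stmt-30571) development — see the module docstring; statement and proof verbatim from the lens-3 g9 landing file. -/
@[simp] theorem monomialRep_integrand (T : RTerm n) (hT : T.Admissible) (i : Fin T.k) :
    (monomialRep T hT i).integrand = T.monomialFun i := rfl

/-- `fibre_cyl_of_mem`: auxiliary theorem of the `RegFoldingDegOne` (stmt-30571) development — see the module docstring; statement and proof verbatim from the lens-3 g9 landing file. -/
theorem fibre_cyl_of_mem {σ : Set (Fin n → ℝ)} {x : Fin n → ℝ} (hx : x ∈ σ) :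
    {t : ℝ | (Fin.snoc x t : Fin (n + 1) → ℝ) ∈ cyl σ} = Ioo (0 : ℝ) 1 := by
  ext t
  simp only [cyl, mem_setOf_eq, Fin.init_snoc, Fin.snoc_last, mem_Ioo]
  exact ⟨fun h => h.2, fun h => ⟨hx, h⟩⟩

/-- `fibre_cyl_of_not_mem`: auxiliary theorem of the `RegFoldingDegOne` (stmt-30571) development — see the module docstring; statement and proof verbatim from the lens-3 g9 landing file. -/
theorem fibre_cyl_of_not_mem {σ : Set (Fin n → ℝ)} {x : Fin n → ℝ} (hx : x ∉ σ) :
    {t : ℝ | (Fin.snoc x t : Fin (n + 1) → ℝ) ∈ cyl σ} = ∅ := by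
  ext t
  simp only [cyl, mem_setOf_eq, Fin.init_snoc, Fin.snoc_last, mem_empty_iff_false, iff_false,
    not_and]
  exact fun h _ => (hx h).elim

/-- Fibre integral of an unfolded monomial: `1_σ(x) · hᵢ(x) ℓ(κᵢ(x))`. -/
theorem fibreIntegral_monomialRep (T : RTerm n) (hT : T.Admissible) (i : Fin T.k) (x : Fin n → ℝ) :
    (∫ t in {t : ℝ | (Fin.snoc x t : Fin (n + 1) → ℝ) ∈ (monomialRep T hT i).domain},
        (monomialRep T hT i).integrand (Fin.snoc x t)) =
      T.domain.indicator (fun x => T.h i x * ell (T.M i) (T.e i) (T.κ i x)) x := by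
  rw [monomialRep_domain, monomialRep_integrand]
  by_cases hx : x ∈ T.domain
  · rw [indicator_of_mem hx, fibre_cyl_of_mem hx]
    simp only [monomialFun, Fin.init_snoc, Fin.snoc_last]
    rw [integral_const_mul]
    rfl
  · rw [indicator_of_notMem hx, fibre_cyl_of_not_mem hx, Measure.restrict_empty,
      integral_zero_measure]

/-- Value of an unfolded monomial: `∫_σ hᵢ ℓ(κᵢ)`. -/
theorem value_monomialRep (T : RTerm n) (hT : T.Admissible) (i : Fin T.k) :
    (monomialRep T hT i).value = ∫ x in T.domain, T.h i x * ell (T.M i) (T.e i) (T.κ i x) := by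
  rw [value_eq_integral_fibre]
  simp_rw [fibreIntegral_monomialRep]
  exact integral_indicator (KZ.IntegralRep.measurableSet_domain_holds (baseRep T hT))

/-- **`eval ∘ unfold`**: `eval (unfold T) = ∫_σ (h₀ + Σᵢ hᵢ ℓ(κᵢ))`. -/
theorem eval_unfold (T : RTerm n) (hT : T.Admissible) :
    KZ.eval (unfold T hT) = ∫ x in T.domain, T.integrand x := by
  rw [unfold, map_add, map_sum, KZ.eval_of]
  simp_rw [KZ.eval_of, value_monomialRep]
  rw [← integral_finsetSum _ (fun i _ => hT.integrableOn_monomial_base i)]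
  have e0 : (baseRep T hT).value = ∫ x in T.domain, T.h₀ x := rfl
  rw [e0, ← integral_add hT.integrableOn_h₀
    (integrable_finsetSum _ fun i _ => hT.integrableOn_monomial_base i)]
  rfl

end RTerm

/-! ## §2 The typed statements -/

/-- KZ's literal rational shape with `deg_t q ≤ d` (verbatim from g7). [folklore] -/
def IsRationalDegLE (d : ℕ) (r : KZ.IntegralRep (1 + 1)) : Prop :=
  ∃ p q : MvPolynomial (Fin (1 + 1)) ℚ, MvPolynomial.degreeOf (Fin.last 1) q ≤ d ∧
    (∀ z ∈ r.domain, MvPolynomial.aeval z q ≠ 0) ∧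
    EqOn r.integrand (fun z => MvPolynomial.aeval z p / MvPolynomial.aeval z q) r.domain

/-- `isRationalDegLE_mono`: auxiliary theorem of the `RegFoldingDegOne` (stmt-30571) development — see the module docstring; statement and proof verbatim from the lens-3 g9 landing file. -/
theorem isRationalDegLE_mono {d d' : ℕ} (hdd : d ≤ d') {r : KZ.IntegralRep (1 + 1)}
    (h : IsRationalDegLE d r) : IsRationalDegLE d' r := by
  obtain ⟨p, q, hq, h1, h2⟩ := h
  exact ⟨p, q, hq.trans hdd, h1, h2⟩

/-- `isRational_of_isRationalDegLE`: auxiliary theorem of the `RegFoldingDegOne` (stmt-30571) development — see the module docstring; statement and proof verbatim from the lens-3 g9 landing file. -/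
theorem isRational_of_isRationalDegLE {d : ℕ} {r : KZ.IntegralRep (1 + 1)}
    (h : IsRationalDegLE d r) : r.IsRational := by
  obtain ⟨p, q, -, hq, he⟩ := h
  exact ⟨p, q, hq, he⟩

/-- **REGULARISED FOLDING in `t`-degree `≤ d`** (CALCULUS; replaces the refuted `LogFoldingDegOne`):
every KZ-rational 2-dimensional `r = [D, p/q]` with `deg_t q ≤ d` is equivalent in `KZ.relations` to
the unfolding of an admissible regularised term over `ℝ¹` with the same fibre integrals a.e. -/
def RegFolding (d : ℕ) : Prop :=
  ∀ r : KZ.IntegralRep (1 + 1), IsRationalDegLE d r →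
    ∃ (T : RTerm 1) (hT : T.Admissible), KZ.of r - RTerm.unfold T hT ∈ KZ.relations ∧
      ∀ᵐ x : (Fin 1 → ℝ), (∫ t in {t : ℝ | (Fin.snoc x t : Fin (1 + 1) → ℝ) ∈ r.domain},
          r.integrand (Fin.snoc x t)) = T.domain.indicator T.integrand x

/-! ## §7 A.e.-congruence of representations; the monomial-free case of `RegKernelPairDegOne` (PROVED)

Two representations (any dimension) whose ZERO-EXTENDED integrands agree a.e. differ by a relation.
This is the `k = k' = 0` instance of `RegKernelPairDegOne` (no monomials) and the lemma every prover of
the regularised pieces needs to pass from "fibre identity off a finite set" to `KZ.relations`.  Proof: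
shrink each domain to the non-vanishing set of its integrand (domain additivity + a zero piece), then
the two shrunken representations have a.e.-equal domains and integrands, and the equaliser argument of
`KZ.IsDominatedFamily.of_sub_of_mem_relations` applies (null pieces are relations; congruence on the
equaliser). -/

namespace AECongr

variable {m : ℕ}

/-- `[σ, f] − [{x ∈ σ | f x ≠ 0}, f] ∈ relations` (the complement carries the zero integrand). -/
theorem of_sub_of_restrict_support_mem (r : KZ.IntegralRep m) :
    ∃ (hE : IsSemialgebraic ℚ {x | x ∈ r.domain ∧ r.integrand x ≠ 0})
      (hEr : {x | x ∈ r.domain ∧ r.integrand x ≠ 0} ⊆ r.domain),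
      KZ.of r - KZ.of (r.restrict _ hE hEr) ∈ KZ.relations := by
  have hZ : IsSemialgebraic ℚ {x | x ∈ r.domain ∧ r.integrand x = (fun _ => ((0 : ℚ) : ℝ)) x} :=
    isSemialgebraic_sep_eq r.isSemialgebraicFunOn_integrand
      (isSemialgebraicFunOn_ratCast r.isSemialgebraic_domain 0)
  have hZ' : IsSemialgebraic ℚ {x | x ∈ r.domain ∧ r.integrand x = 0} := by
    convert hZ using 2; simp
  have hE : IsSemialgebraic ℚ {x | x ∈ r.domain ∧ r.integrand x ≠ 0} := by
    convert r.isSemialgebraic_domain.diff hZ' using 1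
    ext x
    simp only [mem_setOf_eq, Set.mem_sdiff, not_and]
    tauto
  have hEr : {x | x ∈ r.domain ∧ r.integrand x ≠ 0} ⊆ r.domain := fun x hx => hx.1
  have hZr : {x | x ∈ r.domain ∧ r.integrand x = 0} ⊆ r.domain := fun x hx => hx.1
  refine ⟨hE, hEr, ?_⟩
  have hdom : r.domain = (r.restrict _ hE hEr).domain ∪ (r.restrict _ hZ' hZr).domain := by
    ext x
    simp only [KZ.IntegralRep.domain_restrict, mem_union, mem_setOf_eq]
    by_cases hx : r.integrand x = 0 <;> simp [hx]
  have hadd : KZ.of r - KZ.of (r.restrict _ hE hEr) - KZ.of (r.restrict _ hZ' hZr) ∈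
      KZ.domainAddRel := by
    refine ⟨m, r, r.restrict _ hE hEr, r.restrict _ hZ' hZr, hdom, ?_, fun _ _ => rfl,
      fun _ _ => rfl, rfl⟩
    have : (r.restrict _ hE hEr).domain ∩ (r.restrict _ hZ' hZr).domain = ∅ := by
      ext x
      simp only [KZ.IntegralRep.domain_restrict, mem_inter_iff, mem_setOf_eq, mem_empty_iff_false,
        iff_false, not_and, and_imp]
      exact fun _ h _ => h
    rw [this, measure_empty]
  have hzero : KZ.of (r.restrict _ hZ' hZr) ∈ KZ.relations :=
    KZ.of_mem_relations_of_eqOn_zero _ fun x hx => hx.2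
  have := KZ.relations.add_mem (KZ.domainAddRel_subset_relations hadd) hzero
  simpa using this

end AECongr

end RegularisedLogLayer

end Summit.KontsevichZagierPeriods.RootDecompRelativeModAbsolute.Rung30571

end
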